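import Summits.ResolutionOfSingularities.ResolutionOfSingularities.Theorems.EquisingularLiftEquisingularLiftNatTowerInvBFourDefs
import HarnessLib

/-!
# [OURS · L1 W4.5(b) · EL♮(3) · T23-A‴] THE EMPTY RUNNING SURFACE — `Tower.Exc₄` / `Tower.StageB₄` / `Tower.InvB₄` with `E := ∅`, `K := ∅`
# (bookkeeping for the third disjunct «`E'' = ∅`» of the D13 tail rule `TowerPRamGamma`'s E-menu, ✓ …NatResidueHypDefsE7 p711287, desk R76 (ii))

res-L1-w45b-nose-w1 g7 (WIDTH seat D-0157 DOOR 1; helper for the D13 «(P-ram-Γ) / E-ROUND» engine of res-L1-w45b-stub-4 / res-L1-w45b-stub-2,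
sizing = res-L1-w45b-idea-2 g30 (α′) STATUS 2026-08-29T09:27:24Z «`Tower.exc₄_empty` … witness `⊤`» and res-type-027 g23 (α′) 09:24:01Z).
Crux EL♮(3) = stmt-ResolutionOfSingularities-20148 (parent EL♮ stmt-…-20038). OURS; NOT a statement of any manuscript ([Hironaka2017] is a candidate
under adjudication, nothing of it is asserted); AI-written, weaker than expert review. DEF-FREE; no `sorry`; standard axioms.
`--kind proof --supports stmt-ResolutionOfSingularities-20148 --as helper`.

WHAT. The A‴ stage invariant never requires the running exceptional surface `E` to be non-empty (027 / idea-2 / idea-3 (α′) by type): with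
`E = ∅` and the shadow forgotten (`K = ∅`) the model-carrying datum `Tower.Exc₄` is INHABITED BY THE UNIT IDEAL SHEAF `𝓔 := ⊤` —
(e-i) `(⊤).comap jG = ⊤ = 𝓘⟨∅⟩` (`comap_top`, `vanishingIdeal_bot`), (e-ii) `(⊤)_z = ⊤` is principal (`stalkIdeal_top`), (e-iii) `V(⊤)` is the EMPTY
scheme, regular vacuously, (e-iv) `supp ⊤ = ∅`, (e-v) the ruled datum AT `⊤` — a hypothesis for an abstract `Ruled`, and AUTOMATIC for the engine's
datum `FE := «V(𝓔) → Spec O flat»` (a morphism out of the empty scheme is flat: no stalks), and `Shadow₃` by its `K = ∅` disjunct.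
Consequences (pure logic): `Tower.stageB₄_running_empty` / `Tower.invB₄_running_empty` — in ANY reached A‴ stage one may DROP the running surface
(`E ↦ ∅`, `K ↦ ∅`; optionally keeping the old `E` as a model-carrying MEMBER, `Tower.invB₄_running_empty_cons`), the upstairs stage, `T` and both lists
unchanged; the `FE` specialisations `Tower.exc₄_empty_FE` / `Tower.invB₄_running_empty_FE` / `Tower.invB₄_running_empty_cons_FE` are hypothesis-free, and
`Tower.inv₁TriplePrime_running_empty_FE` is the same on the nose engine's `INV₁‴ := (InvB₄ FE … ∧ K-side facts) ∧ hcar ∧ IsLocallyNoetherian F₉`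
(the `R` of ✓ `Tower.towerPtRegB₄_invB₁_FE` / `Tower.towerPtRamB₄_invB₁_FE`, …NatTowerBTriplePrimePointStepsFE). USE (D13 engine, third E-menu
disjunct; S_pp's (E3) point `y₀ ∈ E`, `Es = []`): drop `E` FIRST (`…_running_empty`), then every existing step lemma fires through its first menu
disjunct `pt ∉ ∅` (✓ `Tower.invB₄_ptRamStep` / `invB₄_ptRegStep`), whose output running surface `closure (υ₂ ⁻¹' (∅ \ {pt}))` is `∅` again
(✓ `Sections.closure_preimage_empty_diff`, …NatShadowEmpty — res-L1-w45b-lead-2's `K = ∅` bookkeeping; not re-stated here). [cite: StacksProject, Tag 02IS] (regular scheme = all local rings regular; vacuous for the empty scheme)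
-/

set_option linter.dupNamespace false -- mandated namespace `Summit.<Summit>.<Problem>` of this single-conjunct summit

noncomputable section

open CategoryTheory CategoryTheory.Limits AlgebraicGeometry TopologicalSpace Topology IsLocalRing
open Literature.AlgebraicGeometry.Resolution
open AlgebraicGeometry.Scheme.IdealSheafData

namespace Summit.ResolutionOfSingularities.ResolutionOfSingularities.Cruxes.EquisingularLiftNat.Sections.Tower

/-! ## A morphism out of the empty closed subscheme is flat -/

/-- A morphism out of the EMPTY closed subscheme `V(⊤) ⊂ X` (followed by anything) is flat: flatness is stalkwise and `V(⊤)` has no points.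
[folklore; Mathlib `Flat.of_stalkMap`] -/
theorem flat_topSubschemeι_comp (X : Scheme.{0}) {S : Scheme.{0}} (f : X ⟶ S) :
    Flat ((⊤ : X.IdealSheafData).subschemeι ≫ f) :=
  Flat.of_stalkMap _ fun x => isEmptyElim x

variable (O : Type) [CommRing O] (k : Type) [Field k] (θ : O →+* k)
  (P : Scheme.{0}) (q : P ⟶ Spec (.of O)) (Y : Set P) (Ch : ∀ X' : Scheme.{0}, (X' ⟶ P) → Set X' → Prop)

/-! ## `Exc₄` / `StageB₄` / `InvB₄` at the empty running surface (abstract `Ruled`, the ruled datum at `⊤` as a hypothesis) -/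

/-- **`Tower.Exc₄` at `E = ∅`, `K = ∅` is inhabited by `𝓔 := ⊤`**, given the ruled datum at `⊤`. [OURS · L1 W4.5b · T23-A‴ bookkeeping] -/
theorem exc₄_empty (Ruled : RuledDatum P) {F₉ : Scheme.{0}} (Z₉ : Set F₉) (hZ₉ : IsClosed Z₉) {F₁₀ : Scheme.{0}} (υ' : F₁₀ ⟶ F₉)
    (G : Scheme.{0}) (γ : G ⟶ F₁₀) (hE : IsClosed (∅ : Set G)) (X : Scheme.{0}) (σ : X ⟶ P) (jG : G ⟶ X)
    (hRuled : Ruled F₉ Z₉ hZ₉ F₁₀ υ' G γ ∅ X σ jG ⊤) :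
    Exc₄ O P q Y Ruled Z₉ hZ₉ υ' G γ ∅ hE ∅ X σ jG := by
  have hbot : (⟨∅, hE⟩ : Closeds G) = ⊥ := Closeds.ext rfl
  refine ⟨⊤, ?_, ?_, ?_, ?_, hRuled, Or.inl rfl⟩
  · rw [Scheme.IdealSheafData.comap_top, hbot, vanishingIdeal_bot]
  · intro z
    rw [stalkIdeal_top]
    exact ⟨⟨1, by rw [Ideal.submodule_span_eq, Ideal.span_singleton_one]⟩⟩
  · intro x
    exact isEmptyElim x
  · rw [Scheme.IdealSheafData.support_top, Closeds.coe_bot, Set.image_empty]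
    exact Set.empty_subset _

/-- **Dropping the running surface in a stage body**: `StageB₄ … T E Es K X σ S jG tG ⇒ StageB₄ … T ∅ Es ∅ X σ S jG tG` (same upstairs stage),
given the ruled datum at `⊤`. [OURS · pure logic over `exc₄_empty`] -/
theorem stageB₄_running_empty (Ruled : RuledDatum P) {F₉ : Scheme.{0}} (Z₉ : Set F₉) (hZ₉ : IsClosed Z₉) {F₁₀ : Scheme.{0}} (υ' : F₁₀ ⟶ F₉)
    (G : Scheme.{0}) (γ : G ⟶ F₁₀) (T E : Set G) (Es : List (Set G)) (K : Set G)
    (X : Scheme.{0}) (σ : X ⟶ P) (S : Set X) (jG : G ⟶ X) (tG : G ⟶ Spec (.of k))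
    (h : StageB₄ O k θ P q Y Ch Ruled Z₉ hZ₉ υ' G γ T E Es K X σ S jG tG) (hRuled : Ruled F₉ Z₉ hZ₉ F₁₀ υ' G γ ∅ X σ jG ⊤) :
    StageB₄ O k θ P q Y Ch Ruled Z₉ hZ₉ υ' G γ T ∅ Es ∅ X σ S jG tG := by
  obtain ⟨hCh, hX, hXn, hXr, hdom, hsq, hTS, -, hF⟩ := h
  exact ⟨hCh, hX, hXn, hXr, hdom, hsq, hTS, fun hE => exc₄_empty O P q Y Ruled Z₉ hZ₉ υ' G γ hE X σ jG hRuled, hF⟩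

/-- **Dropping the running surface in a reached A‴ stage**: `InvB₄ … G γ T E Es Ns K ⇒ InvB₄ … G γ T ∅ Es Ns ∅`, given the ruled datum at `⊤` over
every upstairs stage (for the engine's `FE` this is automatic, `invB₄_running_empty_FE`). `¬ T ⊆ ∅` because `T` is irreducible, hence non-empty.
[OURS · pure logic over `exc₄_empty`] -/
theorem invB₄_running_empty (Ruled : RuledDatum P) (F₉ : Scheme.{0}) (Z₉ : Set F₉) (hZ₉ : IsClosed Z₉) (F₁₀ : Scheme.{0}) (υ' : F₁₀ ⟶ F₉)
    (G : Scheme.{0}) (γ : G ⟶ F₁₀) (T E : Set G) (Es Ns : List (Set G)) (K : Set G)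
    (h : InvB₄ O k θ P q Y Ch Ruled F₉ Z₉ hZ₉ F₁₀ υ' G γ T E Es Ns K)
    (hRuled : ∀ (X : Scheme.{0}) (σ : X ⟶ P) (jG : G ⟶ X), Ruled F₉ Z₉ hZ₉ F₁₀ υ' G γ ∅ X σ jG ⊤) :
    InvB₄ O k θ P q Y Ch Ruled F₉ Z₉ hZ₉ F₁₀ υ' G γ T ∅ Es Ns ∅ := by
  obtain ⟨h1, h2, h3, h4, h5, -, -, hEsB, hNsB, X, σ, S, jG, tG, hst⟩ := h
  exact ⟨h1, h2, h3, h4, h5, isClosed_empty, fun hT => h5.nonempty.ne_empty (Set.subset_empty_iff.mp hT), hEsB, hNsB, X, σ, S, jG, tG,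
    stageB₄_running_empty O k θ P q Y Ch Ruled Z₉ hZ₉ υ' G γ T E Es K X σ S jG tG hst (hRuled X σ jG)⟩

/-- **Dropping the running surface while KEEPING it as a model-carrying member** (shadow forgotten): `InvB₄ … T E Es Ns K ⇒ InvB₄ … T ∅ (E :: Es) Ns ∅`.
[OURS · pure logic: `invB₄_cons_running` then `invB₄_running_empty`] -/
theorem invB₄_running_empty_cons (Ruled : RuledDatum P) (F₉ : Scheme.{0}) (Z₉ : Set F₉) (hZ₉ : IsClosed Z₉) (F₁₀ : Scheme.{0}) (υ' : F₁₀ ⟶ F₉)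
    (G : Scheme.{0}) (γ : G ⟶ F₁₀) (T E : Set G) (Es Ns : List (Set G)) (K : Set G)
    (h : InvB₄ O k θ P q Y Ch Ruled F₉ Z₉ hZ₉ F₁₀ υ' G γ T E Es Ns K)
    (hRuled : ∀ (X : Scheme.{0}) (σ : X ⟶ P) (jG : G ⟶ X), Ruled F₉ Z₉ hZ₉ F₁₀ υ' G γ ∅ X σ jG ⊤) :
    InvB₄ O k θ P q Y Ch Ruled F₉ Z₉ hZ₉ F₁₀ υ' G γ T ∅ (E :: Es) Ns ∅ :=
  invB₄_running_empty O k θ P q Y Ch Ruled F₉ Z₉ hZ₉ F₁₀ υ' G γ T E (E :: Es) Ns K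
    (invB₄_cons_running O k θ P q Y Ch Ruled F₉ Z₉ hZ₉ F₁₀ υ' G γ T E Es Ns K h) hRuled

/-! ## The engine's datum `FE := «V(𝓔) → Spec O is flat»`: hypothesis-free specialisations -/

/-- **`Tower.Exc₄` at `E = ∅`, `K = ∅` for the engine's datum `FE`** — no hypothesis (`V(⊤) = ∅ → Spec O` is flat). [OURS · T23-A‴ bookkeeping] -/
theorem exc₄_empty_FE {F₉ : Scheme.{0}} (Z₉ : Set F₉) (hZ₉ : IsClosed Z₉) {F₁₀ : Scheme.{0}} (υ' : F₁₀ ⟶ F₉)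
    (G : Scheme.{0}) (γ : G ⟶ F₁₀) (hE : IsClosed (∅ : Set G)) (X : Scheme.{0}) (σ : X ⟶ P) (jG : G ⟶ X) :
    Exc₄ O P q Y (fun _ _ _ _ _ _ _ _ _ σ _ 𝓔 => Flat (𝓔.subschemeι ≫ σ ≫ q)) Z₉ hZ₉ υ' G γ ∅ hE ∅ X σ jG :=
  exc₄_empty O P q Y _ Z₉ hZ₉ υ' G γ hE X σ jG (flat_topSubschemeι_comp X (σ ≫ q))

/-- **Dropping the running surface, engine datum `FE`** — no hypothesis. [OURS · pure logic] -/
theorem invB₄_running_empty_FE (F₉ : Scheme.{0}) (Z₉ : Set F₉) (hZ₉ : IsClosed Z₉) (F₁₀ : Scheme.{0}) (υ' : F₁₀ ⟶ F₉)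
    (G : Scheme.{0}) (γ : G ⟶ F₁₀) (T E : Set G) (Es Ns : List (Set G)) (K : Set G)
    (h : InvB₄ O k θ P q Y Ch (fun _ _ _ _ _ _ _ _ _ σ _ 𝓔 => Flat (𝓔.subschemeι ≫ σ ≫ q)) F₉ Z₉ hZ₉ F₁₀ υ' G γ T E Es Ns K) :
    InvB₄ O k θ P q Y Ch (fun _ _ _ _ _ _ _ _ _ σ _ 𝓔 => Flat (𝓔.subschemeι ≫ σ ≫ q)) F₉ Z₉ hZ₉ F₁₀ υ' G γ T ∅ Es Ns ∅ :=
  invB₄_running_empty O k θ P q Y Ch _ F₉ Z₉ hZ₉ F₁₀ υ' G γ T E Es Ns K h fun X σ _ => flat_topSubschemeι_comp X (σ ≫ q)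

/-- **Dropping the running surface while keeping it as a member, engine datum `FE`** — no hypothesis. [OURS · pure logic] -/
theorem invB₄_running_empty_cons_FE (F₉ : Scheme.{0}) (Z₉ : Set F₉) (hZ₉ : IsClosed Z₉) (F₁₀ : Scheme.{0}) (υ' : F₁₀ ⟶ F₉)
    (G : Scheme.{0}) (γ : G ⟶ F₁₀) (T E : Set G) (Es Ns : List (Set G)) (K : Set G)
    (h : InvB₄ O k θ P q Y Ch (fun _ _ _ _ _ _ _ _ _ σ _ 𝓔 => Flat (𝓔.subschemeι ≫ σ ≫ q)) F₉ Z₉ hZ₉ F₁₀ υ' G γ T E Es Ns K) :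
    InvB₄ O k θ P q Y Ch (fun _ _ _ _ _ _ _ _ _ σ _ 𝓔 => Flat (𝓔.subschemeι ≫ σ ≫ q)) F₉ Z₉ hZ₉ F₁₀ υ' G γ T ∅ (E :: Es) Ns ∅ :=
  invB₄_running_empty_cons O k θ P q Y Ch _ F₉ Z₉ hZ₉ F₁₀ υ' G γ T E Es Ns K h fun X σ _ => flat_topSubschemeι_comp X (σ ≫ q)

/-- **Dropping the running surface on the nose engine's full invariant `INV₁‴(FE)`** (= the `R` of ✓ `Tower.towerPtRegB₄_invB₁_FE` /
`Tower.towerPtRamB₄_invB₁_FE`): `InvB₄`-part by `invB₄_running_empty_FE`; the K-side facts at `K = ∅` (`∅ ≠ univ` because `T ≠ ∅`); the carrier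
datum and `IsLocallyNoetherian F₉` untouched. With `hcons` one chooses whether the old `E` is kept as a member. [OURS · pure logic] -/
theorem inv₁TriplePrime_running_empty_FE (F₉ : Scheme.{0}) (Z₉ : Set F₉) (hZ₉ : IsClosed Z₉) (F₁₀ : Scheme.{0}) (υ' : F₁₀ ⟶ F₉)
    (G : Scheme.{0}) (γ : G ⟶ F₁₀) (T E : Set G) (Es Ns : List (Set G)) (K : Set G) (Es₀ : List (Set G)) (hcons : Es₀ = Es ∨ Es₀ = E :: Es)
    (h : (Tower.InvB₄ O k θ P q Y Ch (fun _ _ _ _ _ _ _ _ _ σ _ 𝓔 => Flat (𝓔.subschemeι ≫ σ ≫ q)) F₉ Z₉ hZ₉ F₁₀ υ' G γ T E Es Ns K ∧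
          IsClosed K ∧ K ⊆ closure (K \ E) ∧ K ≠ Set.univ) ∧
        (∀ z : ↥(redSub F₉ Z₉ hZ₉), IsClosed ({z} : Set ↥(redSub F₉ Z₉ hZ₉)) →
          ringKrullDim ((redSub F₉ Z₉ hZ₉).presheaf.stalk z) = ((1 : ℕ) : WithBot ℕ∞)) ∧ IsLocallyNoetherian F₉) :
    (Tower.InvB₄ O k θ P q Y Ch (fun _ _ _ _ _ _ _ _ _ σ _ 𝓔 => Flat (𝓔.subschemeι ≫ σ ≫ q)) F₉ Z₉ hZ₉ F₁₀ υ' G γ T ∅ Es₀ Ns ∅ ∧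
        IsClosed (∅ : Set G) ∧ (∅ : Set G) ⊆ closure (∅ \ ∅) ∧ (∅ : Set G) ≠ Set.univ) ∧
      (∀ z : ↥(redSub F₉ Z₉ hZ₉), IsClosed ({z} : Set ↥(redSub F₉ Z₉ hZ₉)) →
        ringKrullDim ((redSub F₉ Z₉ hZ₉).presheaf.stalk z) = ((1 : ℕ) : WithBot ℕ∞)) ∧ IsLocallyNoetherian F₉ := by
  obtain ⟨⟨hinv, -, -, -⟩, hcar, hF₉⟩ := h
  have hTne : T.Nonempty := by
    obtain ⟨-, -, -, -, hTirr, -⟩ := hinv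
    exact hTirr.nonempty
  have huniv : (∅ : Set G) ≠ Set.univ := fun h0 => by
    obtain ⟨t, -⟩ := hTne
    exact (h0.symm ▸ Set.mem_univ t : t ∈ (∅ : Set G))
  refine ⟨⟨?_, isClosed_empty, Set.empty_subset _, huniv⟩, hcar, hF₉⟩
  rcases hcons with rfl | rfl
  · exact invB₄_running_empty_FE O k θ P q Y Ch F₉ Z₉ hZ₉ F₁₀ υ' G γ T E _ Ns K hinv
  · exact invB₄_running_empty_cons_FE O k θ P q Y Ch F₉ Z₉ hZ₉ F₁₀ υ' G γ T E _ Ns K hinv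

/-! ## Appended 2026-08-29 (res-L1-w45b-nose-w1 g7): the SHADOW-KEEPING twins — drop the running surface `E ↦ ∅` but KEEP the cone shadow `K`
(res-L1-w45b-idea-2 g30 remark STATUS 2026-08-29T09:45:33Z: a future rule wanting to keep a shadow through an `E = ∅` step needs this twin; today's
`TowerPRamGamma` forces `K'' = ∅` and uses the `K ↦ ∅` lemmas above). `Shadow₃`'s second disjunct reads the running surface's model `𝓔` only in
(k-iii) flatness of `V(𝓔 ⊔ 𝒦)`, (k-iv) conditional regularity at points of `V(𝓔 ⊔ 𝒦)`, (k-v)/(k-vi) the two Cartier clauses — at `𝓔 := ⊤` all four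
are free (`⊤ ⊔ 𝒦 = ⊤` has empty subscheme; `IsEffectiveCartier ⊤`, Literature `isEffectiveCartier_top`; a Cartier condition on the empty scheme is
vacuous), and (k-i)/(k-ii-loc) are the cone's own. -/

/-- **The cone shadow survives dropping the running surface**: `Shadow₃ … G E hE K X σ jG 𝓔 ⇒ Shadow₃ … G ∅ hE₀ K X σ jG ⊤`.
[OURS · pure logic + four facts about `⊤`] -/
theorem shadow₃_running_empty {G : Scheme.{0}} {E : Set G} {hE : IsClosed E} {K : Set G} {X : Scheme.{0}} {σ : X ⟶ P} {jG : G ⟶ X}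
    {𝓔 : X.IdealSheafData} (h : Shadow₃ O P q G E hE K X σ jG 𝓔) (hE₀ : IsClosed (∅ : Set G)) :
    Shadow₃ O P q G ∅ hE₀ K X σ jG ⊤ := by
  rcases h with h | ⟨𝒦, h1, ⟨V, -, h2⟩, -, -, -, -⟩
  · exact Or.inl h
  · refine Or.inr ⟨𝒦, h1, ⟨V, Set.empty_subset _, h2⟩, ?_, ?_, ?_, fun x => isEmptyElim x⟩
    · rw [top_sup_eq]
      exact flat_topSubschemeι_comp X (σ ≫ q)
    · intro y hy _
      exfalso
      rw [top_sup_eq, Scheme.IdealSheafData.support_top] at hy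
      exact hy
    · rw [Scheme.IdealSheafData.comap_top]
      exact isEffectiveCartier_top

/-- **`Tower.Exc₄` at `E = ∅` KEEPING the shadow `K`**: from a model-carrying datum of the old running surface (for its cone data) and the ruled datum
at `⊤`. [OURS · T23-A‴ bookkeeping] -/
theorem exc₄_running_empty_keepShadow (Ruled : RuledDatum P) {F₉ : Scheme.{0}} (Z₉ : Set F₉) (hZ₉ : IsClosed Z₉) {F₁₀ : Scheme.{0}} (υ' : F₁₀ ⟶ F₉)
    (G : Scheme.{0}) (γ : G ⟶ F₁₀) {E : Set G} {hE : IsClosed E} {K : Set G} (hE₀ : IsClosed (∅ : Set G)) (X : Scheme.{0}) (σ : X ⟶ P)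
    (jG : G ⟶ X) (h : Exc₄ O P q Y Ruled Z₉ hZ₉ υ' G γ E hE K X σ jG) (hRuled : Ruled F₉ Z₉ hZ₉ F₁₀ υ' G γ ∅ X σ jG ⊤) :
    Exc₄ O P q Y Ruled Z₉ hZ₉ υ' G γ ∅ hE₀ K X σ jG := by
  obtain ⟨𝓔, -, -, -, -, -, hK⟩ := h
  have hbot : (⟨∅, hE₀⟩ : Closeds G) = ⊥ := Closeds.ext rfl
  refine ⟨⊤, ?_, ?_, fun x => isEmptyElim x, ?_, hRuled, shadow₃_running_empty O P q hK hE₀⟩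
  · rw [Scheme.IdealSheafData.comap_top, hbot, vanishingIdeal_bot]
  · intro z
    rw [stalkIdeal_top]
    exact ⟨⟨1, by rw [Ideal.submodule_span_eq, Ideal.span_singleton_one]⟩⟩
  · rw [Scheme.IdealSheafData.support_top, Closeds.coe_bot, Set.image_empty]
    exact Set.empty_subset _

/-- **Dropping the running surface in a reached A‴ stage, KEEPING the shadow**: `InvB₄ … G γ T E Es Ns K ⇒ InvB₄ … G γ T ∅ Es Ns K`, given the ruled
datum at `⊤` over every upstairs stage. [OURS · pure logic] -/
theorem invB₄_running_empty_keepShadow (Ruled : RuledDatum P) (F₉ : Scheme.{0}) (Z₉ : Set F₉) (hZ₉ : IsClosed Z₉) (F₁₀ : Scheme.{0})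
    (υ' : F₁₀ ⟶ F₉) (G : Scheme.{0}) (γ : G ⟶ F₁₀) (T E : Set G) (Es Ns : List (Set G)) (K : Set G)
    (h : InvB₄ O k θ P q Y Ch Ruled F₉ Z₉ hZ₉ F₁₀ υ' G γ T E Es Ns K)
    (hRuled : ∀ (X : Scheme.{0}) (σ : X ⟶ P) (jG : G ⟶ X), Ruled F₉ Z₉ hZ₉ F₁₀ υ' G γ ∅ X σ jG ⊤) :
    InvB₄ O k θ P q Y Ch Ruled F₉ Z₉ hZ₉ F₁₀ υ' G γ T ∅ Es Ns K := by
  obtain ⟨h1, h2, h3, h4, h5, hEcl, -, hEsB, hNsB, X, σ, S, jG, tG, hCh, hX, hXn, hXr, hdom, hsq, hTS, hE, hF⟩ := h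
  exact ⟨h1, h2, h3, h4, h5, isClosed_empty, fun hT => h5.nonempty.ne_empty (Set.subset_empty_iff.mp hT), hEsB, hNsB, X, σ, S, jG, tG,
    hCh, hX, hXn, hXr, hdom, hsq, hTS,
    fun hE₀ => exc₄_running_empty_keepShadow O P q Y Ruled Z₉ hZ₉ υ' G γ hE₀ X σ jG (hE hEcl) (hRuled X σ jG), hF⟩

/-- **Dropping the running surface, keeping the shadow, engine datum `FE`** — no hypothesis. [OURS · pure logic] -/
theorem invB₄_running_empty_keepShadow_FE (F₉ : Scheme.{0}) (Z₉ : Set F₉) (hZ₉ : IsClosed Z₉) (F₁₀ : Scheme.{0}) (υ' : F₁₀ ⟶ F₉)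
    (G : Scheme.{0}) (γ : G ⟶ F₁₀) (T E : Set G) (Es Ns : List (Set G)) (K : Set G)
    (h : InvB₄ O k θ P q Y Ch (fun _ _ _ _ _ _ _ _ _ σ _ 𝓔 => Flat (𝓔.subschemeι ≫ σ ≫ q)) F₉ Z₉ hZ₉ F₁₀ υ' G γ T E Es Ns K) :
    InvB₄ O k θ P q Y Ch (fun _ _ _ _ _ _ _ _ _ σ _ 𝓔 => Flat (𝓔.subschemeι ≫ σ ≫ q)) F₉ Z₉ hZ₉ F₁₀ υ' G γ T ∅ Es Ns K :=
  invB₄_running_empty_keepShadow O k θ P q Y Ch _ F₉ Z₉ hZ₉ F₁₀ υ' G γ T E Es Ns K h fun X σ _ => flat_topSubschemeι_comp X (σ ≫ q)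

/-- **Dropping the running surface, keeping the shadow, on the nose engine's full invariant `INV₁‴(FE)`**: the K-side fact `K ⊆ closure (K ∖ E)`
becomes `K ⊆ closure K`. [OURS · pure logic] -/
theorem inv₁TriplePrime_running_empty_keepShadow_FE (F₉ : Scheme.{0}) (Z₉ : Set F₉) (hZ₉ : IsClosed Z₉) (F₁₀ : Scheme.{0}) (υ' : F₁₀ ⟶ F₉)
    (G : Scheme.{0}) (γ : G ⟶ F₁₀) (T E : Set G) (Es Ns : List (Set G)) (K : Set G)
    (h : (Tower.InvB₄ O k θ P q Y Ch (fun _ _ _ _ _ _ _ _ _ σ _ 𝓔 => Flat (𝓔.subschemeι ≫ σ ≫ q)) F₉ Z₉ hZ₉ F₁₀ υ' G γ T E Es Ns K ∧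
          IsClosed K ∧ K ⊆ closure (K \ E) ∧ K ≠ Set.univ) ∧
        (∀ z : ↥(redSub F₉ Z₉ hZ₉), IsClosed ({z} : Set ↥(redSub F₉ Z₉ hZ₉)) →
          ringKrullDim ((redSub F₉ Z₉ hZ₉).presheaf.stalk z) = ((1 : ℕ) : WithBot ℕ∞)) ∧ IsLocallyNoetherian F₉) :
    (Tower.InvB₄ O k θ P q Y Ch (fun _ _ _ _ _ _ _ _ _ σ _ 𝓔 => Flat (𝓔.subschemeι ≫ σ ≫ q)) F₉ Z₉ hZ₉ F₁₀ υ' G γ T ∅ Es Ns K ∧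
        IsClosed K ∧ K ⊆ closure (K \ ∅) ∧ K ≠ Set.univ) ∧
      (∀ z : ↥(redSub F₉ Z₉ hZ₉), IsClosed ({z} : Set ↥(redSub F₉ Z₉ hZ₉)) →
        ringKrullDim ((redSub F₉ Z₉ hZ₉).presheaf.stalk z) = ((1 : ℕ) : WithBot ℕ∞)) ∧ IsLocallyNoetherian F₉ := by
  obtain ⟨⟨hinv, hKcl, -, hKne⟩, hcar, hF₉⟩ := h
  exact ⟨⟨invB₄_running_empty_keepShadow_FE O k θ P q Y Ch F₉ Z₉ hZ₉ F₁₀ υ' G γ T E Es Ns K hinv, hKcl,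
    by rw [Set.sdiff_empty]; exact subset_closure, hKne⟩, hcar, hF₉⟩

end Summit.ResolutionOfSingularities.ResolutionOfSingularities.Cruxes.EquisingularLiftNat.Sections.Tower

end
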